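import Literature.AlgebraicGeometry.Frobenioids.PadicKummerRemark221General
import Literature.AlgebraicGeometry.Frobenioids.KummerInflationRange
import HarnessLib

/-!
# Frobenioids II, Remark 2.2.1: WHICH clauses of Definition 2.2 (ii) the root statement uses —
# only (a) and the surjectivity of `H¹(H_A, μ_N(A)) → H¹(H, μ_N(A))`

Mochizuki, *The geometry of Frobenioids II*, Kyushu J. Math. **62** (2008) 401–460, §2, Definition 2.2 (ii)
p. 17 and Remark 2.2.1 p. 18 [cite: MochizukiFrdII2008, Rmk 2.2.1 p.18]: "it follows immediately from the
definitions [i.e., by translating into extension field-theoretic language the Galois cohomological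
conditions of Definition 2.2, (ii), (c)] … Moreover, the [first cohomology module portion of the]
Galois-theoretic condition of Definition 2.2, (ii), (c), implies … that any element `f ∈ O^□(A)^H` admits
an `N`-th root `g ∈ O^□(A)`."

PROOF-ONLY companion of `PadicKummerRemark221General.lean` (abc-iut-E-t32 g8; F-1198 closer p468870 under
the FULL `(N, H)`-saturation hypothesis `IsNHSaturated`), abc-iut cell, D-0079 L-F [FrdI/II] row F-1198
(seat abc-iut-w6-d020 g6). This file records the LOAD-BEARING CLAUSES, exactly as print says ("the FIRST
cohomology module portion of … (c)"): of Definition 2.2 (ii) = (a) `μ_N`-saturated ∧ (b) `A_D` Galois ∧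
(c) [`H¹(H_A, μ_N(A)) ⥲ H¹(H, μ_N(A))`, `H¹(H_A, ℤ/Nℤ) ⥲ H¹(H, ℤ/Nℤ)`, `H²(H_A, μ_N(A)) ↠ H²(H, μ_N(A))`], the
root statement at the arithmetic context needs ONLY

* (a) (to put `μ_N(K̄)` inside `L`), and
* the SURJECTIVITY of the `μ_N`-inflation in degree one — in the tree's "extension field-theoretic"
  cocycle form (`Kummer.infl_one_surjective_iff`): every continuous crossed homomorphism
  `H → μ_N(O^□_L)` vanishes on `Ker(H ↠ H_A)`;

clause (b), the `ℤ/Nℤ`-clause, the `H²`-clause and the injectivity half of the `μ_N`-clause are idle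
for it (`invariantsAdmitRoots_ofLocalField_of_isMuSaturated_of_oneCocycles`,
`…_box_of_isMuSaturated_of_oneCocycles`). The chain is that of `PadicKummerRemark221General` —
`#(Eˣ/Eˣᴺ) ≤ #H¹(H, μ_N(A))` (abc-iut-w5-d246 `natCard_unitsModPow_le_natCard_h1_of_algHom`, from the local
unit-index monotonicity and the Kummer injection) and `#(Eˣ/Eˣᴺ) ≤ #H¹(H_A, μ_N(A)) ⇒ Eˣ ⊆ Lˣᴺ`
(abc-iut-L1-t6 `exists_pow_eq_of_index_le_natCard_h1`, Hilbert 90) — with the one link between them,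
`#H¹(H, μ_N(A)) ≤ #H¹(H_A, μ_N(A))`, taken from the surjectivity alone
(`natCard_h1_H_le_natCard_h1_HA_of_oneCocycles`, any context `X` with `H_A`, `μ_N(A)` finite;
`finite_h1_HA_of_finite`). The `IsNHSaturated` form of record (p468870) is recovered as a corollary
(`invariantsAdmitRoots_ofLocalField_of_isNHSaturated'`).

Nothing here concerns [IUTchIII]; classical Kummer theory / Hilbert 90 / local unit indices. Universe `0`.
-/

noncomputable section

namespace Literature.AlgebraicGeometry.Frobenioids

namespace PadicKummer

namespace Def22Context

open Field IntermediateField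
open scoped ValuativeRel
open Literature.NumberTheory.GaloisRepresentations
open Literature.NumberTheory.GaloisRepresentations.LocalWeilDatum

/-! ### Any context: `#H¹(H, μ_N(A)) ≤ #H¹(H_A, μ_N(A))` from the degree-one surjectivity alone -/

section Abstract

variable (X : Def22Context) (N : ℕ)

/-- `H¹(H_A, μ_N(A))` is finite as soon as `H_A` and `μ_N(A)` are (continuous crossed homomorphisms
`H_A → μ_N(A)` are finitely many, and every class has one). [cite: MochizukiFrdII2008, Rmk 2.2.1 p.18] -/
theorem finite_h1_HA_of_finite [Finite X.HA] [Finite (Kummer.Mu N X.O)] :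
    Finite (continuousCohomology 1 (Kummer.muTopRep N X.O X.HA)) := by
  haveI : Finite (Kummer.muTopRep N X.O X.HA) :=
    inferInstanceAs (Finite (Additive (Kummer.Mu N X.O)))
  haveI : Finite (contOneCocycles (Kummer.muTopRep N X.O X.HA)) :=
    Finite.of_injective
      (fun φ : contOneCocycles (Kummer.muTopRep N X.O X.HA) => (φ.1 : X.HA → Kummer.muTopRep N X.O X.HA))
      (fun φ ψ h => Subtype.ext (ContinuousMap.ext fun x => congrFun h x))
  exact Finite.of_surjective _ (oneCocycleClass_surjective (Kummer.muTopRep N X.O X.HA))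

/-- **The one link**: if every continuous crossed homomorphism `H → μ_N(A)` vanishes on
`Ker(H ↠ H_A)` — i.e. `H¹(H_A, μ_N(A)) → H¹(H, μ_N(A))` is SURJECTIVE (`Kummer.infl_one_surjective_iff`)
— then `#H¹(H, μ_N(A)) ≤ #H¹(H_A, μ_N(A))` (for `H_A`, `μ_N(A)` finite).
[cite: MochizukiFrdII2008, Def 2.2 (ii) p.17] -/
theorem natCard_h1_H_le_natCard_h1_HA_of_oneCocycles [Finite X.HA] [Finite (Kummer.Mu N X.O)]
    (hc1 : ∀ c : contOneCocycles (TopRep.res (X.qHA : X.H →* X.HA) (Kummer.muTopRep N X.O X.HA)),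
      ∀ σ, X.qHA σ = 1 → c.1 σ = 0) :
    Nat.card (continuousCohomology 1
        (TopRep.res (X.qHA : X.H →* X.HA) (Kummer.muTopRep N X.O X.HA))) ≤
      Nat.card (continuousCohomology 1 (Kummer.muTopRep N X.O X.HA)) := by
  haveI := finite_h1_HA_of_finite X N
  exact Nat.card_le_card_of_surjective (Kummer.infl X.HA X.qHA (Kummer.muTopRep N X.O X.HA) 1).hom
    ((Kummer.infl_one_surjective_iff (dΓ := Def22Context.instDiscreteTopologyAutE X) X.HA X.qHA
      X.toHA_surjective (Kummer.muTopRep N X.O X.HA)).mpr hc1)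

/-- Under the full `(N, H)`-saturation the cocycle condition holds (the `μ_N`-clause of (c), read
through `isNHSaturated_iff_oneCocycles`). [cite: MochizukiFrdII2008, Def 2.2 (ii) p.17] -/
theorem oneCocycles_vanish_of_isNHSaturated (h : IsNHSaturated X N)
    (c : contOneCocycles (TopRep.res (X.qHA : X.H →* X.HA) (Kummer.muTopRep N X.O X.HA)))
    (σ : X.H) (hσ : X.qHA σ = 1) : c.1 σ = 0 :=
  ((isNHSaturated_iff_oneCocycles X N).mp h).2.2.1 c σ hσ

end Abstract

/-! ### The arithmetic context: Remark 2.2.1 from (a) and the degree-one surjectivity alone -/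

section LocalField

variable (K : Type) [Field K] [ValuativeRel K] [TopologicalSpace K] [IsNonarchimedeanLocalField K]
  [CharZero K] (L : IntermediateField K (AlgebraicClosure K)) [FiniteDimensional K L] [Normal K L]
  (H : Subgroup (absoluteGaloisGroup K)) [H.Normal] (hH : IsOpen (H : Set (absoluteGaloisGroup K)))
  (S : StableSubmonoid L) (N : ℕ) [NeZero N]

/-- **Remark 2.2.1 from the LOAD-BEARING clauses only.** For a non-archimedean local field `K` of
characteristic `0`, `L ⊆ K̄` finite normal, `H ⊴ Γ_K` open, a root-closed `Gal(L/K)`-stable `O^□_L`,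
`N ≥ 1`, and the arithmetic object `A = (L, O^□_L)`: IF (a) `μ_N(A) ≅ ℤ/Nℤ` and every continuous crossed
homomorphism `H → μ_N(A)` vanishes on `Ker(H ↠ H_A)` (⟺ `H¹(H_A, μ_N(A)) → H¹(H, μ_N(A))` surjective),
THEN every `f ∈ O^□(A)^H` has an `N`-th root in `O^□(A)`. Neither "`A_D` Galois", nor the
`ℤ/Nℤ`-clause, nor the `H²`-clause of Definition 2.2 (ii) is used.
[cite: MochizukiFrdII2008, Rmk 2.2.1 p.18] -/
theorem invariantsAdmitRoots_ofLocalField_of_isMuSaturated_of_oneCocycles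
    (hS : ∀ x : L, x ^ N ∈ S.toSubmonoid → x ∈ S.toSubmonoid)
    (ha : Kummer.IsMuSaturated N (GalMonoid S))
    (hc1 : ∀ c : contOneCocycles
        (TopRep.res ((ofLocalField L H hH S).qHA : (ofLocalField L H hH S).H →* (ofLocalField L H hH S).HA)
          (Kummer.muTopRep N (GalMonoid S) (ofLocalField L H hH S).HA)),
      ∀ σ, (ofLocalField L H hH S).qHA σ = 1 → c.1 σ = 0) :
    Kummer.InvariantsAdmitRoots N (GalMonoid S) (ofLocalField L H hH S).HA := by
  intro f hf
  have hS1 : ∀ x : L, x ^ N = 1 → x ∈ S.toSubmonoid := fun x hx =>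
    hS x (by rw [hx]; exact S.toSubmonoid.one_mem)
  -- (a): `μ_N(K̄) ⊆ L`, and `μ_N(A)` is finite
  have hμ := coe_rootsOfUnity_mem_of_isMuSaturated L S N ha
  haveI : Finite (Kummer.Mu N (ofLocalField L H hH S).O) := by
    obtain ⟨e⟩ := ha.nonempty_mulEquiv
    exact Finite.of_equiv _ e.toEquiv.symm
  haveI : Finite (ofLocalField L H hH S).HA :=
    Finite.of_injective (fun h : (ofLocalField L H hH S).HA => (h : L ≃ₐ[K] L))
      Subtype.val_injective
  -- `f.val ∈ E = L^{H_A}`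
  let x : ↥(invariantField L H hH S) :=
    ((invariantsEquiv L H hH S ⟨f, hf⟩ : submonoidOfInvariantField L H hH S) :
      invariantField L H hH S)
  have hxval : ((x : L) : L) = f.val := rfl
  have hx0 : x ≠ 0 := fun h => by
    have h' := congrArg (fun z : ↥(invariantField L H hH S) => ((z : L) : L)) h
    rw [hxval] at h'
    exact GalMonoid.val_ne_zero f h'
  -- the chain `#(Eˣ/Eˣᴺ) ≤ #H¹(H, μ_N(A)) ≤ #H¹(H_A, μ_N(A))`
  let g : ↥(invariantField L H hH S) →ₐ[K]
      ↥(fixedField (H.map (absoluteGaloisGroup.toAlgEquiv K).toMonoidHom)) :=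
    (IntermediateField.inclusion (lift_invariantField_le_fixedField L H hH S)).comp
      (liftAlgEquiv (invariantField L H hH S)).toAlgHom
  have h1 := natCard_unitsModPow_le_natCard_h1_of_algHom H N L hH S hS1 hμ g
  have h2 := natCard_h1_H_le_natCard_h1_HA_of_oneCocycles (ofLocalField L H hH S) N hc1
  obtain ⟨y, hy⟩ := exists_pow_eq_of_index_le_natCard_h1
    (tE := Def22Context.instTopologicalSpaceAutE (ofLocalField L H hH S)) L H hH S N hS1 (NeZero.ne N)
    (index_range_powMonoidHom_invariantField_ne_zero K L H hH S N) (h1.trans h2) x hx0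
  rw [hxval] at hy
  have hyS : y ∈ S.toSubmonoid := hS y (by rw [hy]; exact f.val_mem)
  refine ⟨GalMonoid.mk y hyS, GalMonoid.ext ?_⟩
  rw [GalMonoid.val_pow, GalMonoid.val_mk, hy]

/-- The same for `O^□_L` of Definition 2.2 (iii) (either reading of «fieldwise saturated»;
root-closure is automatic). [cite: MochizukiFrdII2008, Rmk 2.2.1 p.18] -/
theorem invariantsAdmitRoots_ofLocalField_box_of_isMuSaturated_of_oneCocycles (fs : Prop)
    (ha : Kummer.IsMuSaturated N (GalMonoid (boxStableSubmonoid K L fs)))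
    (hc1 : ∀ c : contOneCocycles
        (TopRep.res ((ofLocalField L H hH (boxStableSubmonoid K L fs)).qHA :
            (ofLocalField L H hH (boxStableSubmonoid K L fs)).H →*
              (ofLocalField L H hH (boxStableSubmonoid K L fs)).HA)
          (Kummer.muTopRep N (GalMonoid (boxStableSubmonoid K L fs))
            (ofLocalField L H hH (boxStableSubmonoid K L fs)).HA)),
      ∀ σ, (ofLocalField L H hH (boxStableSubmonoid K L fs)).qHA σ = 1 → c.1 σ = 0) :
    Kummer.InvariantsAdmitRoots N (GalMonoid (boxStableSubmonoid K L fs))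
      (ofLocalField L H hH (boxStableSubmonoid K L fs)).HA :=
  invariantsAdmitRoots_ofLocalField_of_isMuSaturated_of_oneCocycles K L H hH (boxStableSubmonoid K L fs)
    N (fun _ hx => mem_boxStableSubmonoid_of_pow_mem K L N fs (NeZero.pos N) hx) ha hc1

/-- Consistency with the closer of record (p468870): under the FULL `(N, H)`-saturation the two
hypotheses hold ((a) is a field of it; the cocycle condition is its `μ_N`-clause), so Remark 2.2.1
follows again. [cite: MochizukiFrdII2008, Rmk 2.2.1 p.18] -/
theorem invariantsAdmitRoots_ofLocalField_of_isNHSaturated'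
    (hS : ∀ x : L, x ^ N ∈ S.toSubmonoid → x ∈ S.toSubmonoid)
    (hsat : IsNHSaturated (ofLocalField L H hH S) N) :
    Kummer.InvariantsAdmitRoots N (GalMonoid S) (ofLocalField L H hH S).HA :=
  invariantsAdmitRoots_ofLocalField_of_isMuSaturated_of_oneCocycles K L H hH S N hS hsat.muSaturated
    (oneCocycles_vanish_of_isNHSaturated (ofLocalField L H hH S) N hsat)

end LocalField

end Def22Context

end PadicKummer

end Literature.AlgebraicGeometry.Frobenioids

end
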